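import Summits.CriticalPhenomena.SAWScalingLimit.Theorems.SAWDefectDecoherenceBoundaryClosureRInnerPolygonsLocalCells
import Summits.CriticalPhenomena.SAWScalingLimit.Theorems.SAWDefectDecoherenceBoundaryClosureRInnerPolygonsWedges
import Summits.CriticalPhenomena.SAWScalingLimit.Theorems.SAWDefectDecoherenceBoundaryClosureRInnerPolygonsBoundaryWalk
import HarnessLib

/-!
# Crux `BoundaryClosureR` (stmt-CriticalPhenomena-14004), line `polygon-parity-squeeze`,
# stub `stub_innerZigzagPolygon` (7a): levels of the six lattice directions against the six
# inner normals; small balls on a side near a corner; the two open cells along an edge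

Landing target:
`Summits/CriticalPhenomena/SAWScalingLimit/Theorems/SAWDefectDecoherenceBoundaryClosureRInnerZigzagLevels.lean`
(`--supports stmt-CriticalPhenomena-14004`; building block A1 of the registered stub
`stub_innerZigzagPolygon`, the continuum half of the inner-polygon construction (IP)).

The boundary of the inner polygon is a cycle of unit edges of `𝕋` in the six directions
`triDir m`; the side carried by the dart `b → b + triDir m` has the cell union on its LEFT, i.e. its
inner normal is `innerNormal (σ m)`, `σ = ![0,3,5,1,2,4]`.  This file provides:

* `level_triEmbed_triDir` — the table `Re(triEmbed (triDir m) · conj (innerNormal κ)) = (√3/2)·M κ m`,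
  `M ∈ {0, ±1}`; its consequences `level_triDir_sigma` (a direction is on its own side line),
  `level_triDir_sigma_add_three`, and `level_triDir_fan` (the signs met at the five corner types:
  `+` at the convex corners, `-` at the reflex ones);
* `halfPlane_eq_of_level_eq_zero`, `inter_halfPlane_inter_ball_eq`, `union_halfPlane_inter_ball_eq` —
  **a ball of radius `r/2` about a side point at distance `≥ r` from a corner sees only that side**:
  `(H ∩ H') ∩ B = H_z ∩ B` at a convex corner, `(H ∪ H') ∩ B = H_z ∩ B` at a reflex one;
* `edge_trichotomy` — **along an edge, off its ends, the plane is: open left cell / the edge / open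
  right cell** according to the sign of the level against `innerNormal (σ m)` (lattice coordinates).

Sources: folklore plane geometry of the triangular lattice.  No proposition is defined and no
named fact is introduced.
-/

noncomputable section

open scoped ComplexConjugate
open Set Metric
open Literature.Probability.LatticeModels
open Literature.Probability.Percolation (triX triY triCell triCellStrict cellForm triX_triEmbed triY_triEmbed
  triX_add triY_add triX_sub triY_sub triX_smul triY_smul mem_triCellStrict_iff triDir triXY_ext
  triDir_fst_cast triDir_snd_cast abs_triX_sub_le abs_triY_sub_le)
open Summit.CriticalPhenomena.SAWScalingLimit.Theorems.PolygonParitySqueeze.BoundaryWalk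

namespace Summit.CriticalPhenomena.SAWScalingLimit.Theorems.PolygonParitySqueeze.InnerZigzag

/-! ### 1. The direction / normal table -/

/-- **Levels of the six directions against the six inner normals**:
`Re(triEmbed (triDir m) · conj (innerNormal κ)) = (√3/2) · M κ m` with the sign table `M`. [folklore] -/
theorem level_triEmbed_triDir (κ m : Fin 6) :
    (triEmbed (triDir m) * conj (innerNormal κ)).re = Real.sqrt 3 / 2 *
      (![![0, 1, 1, 0, -1, -1], ![0, -1, -1, 0, 1, 1], ![1, 0, -1, -1, 0, 1], ![-1, 0, 1, 1, 0, -1],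
        ![1, 1, 0, -1, -1, 0], ![-1, -1, 0, 1, 1, 0]] : Fin 6 → Fin 6 → ℝ) κ m := by
  have h3 : Real.sqrt 3 * Real.sqrt 3 = 3 := Real.mul_self_sqrt (by norm_num)
  fin_cases κ <;> fin_cases m <;>
    simp [triEmbed, triDir, innerNormal_eq, Complex.mul_re, triZeta_re, triZeta_im] <;> nlinarith [h3]

/-- A direction lies on its own side line: `Re(triDir m · conj n_{σ m}) = 0`, `σ = ![0,3,5,1,2,4]`
(the inner normal of the side carried by a dart of direction `m`, cell union on the left). [folklore] -/
theorem level_triDir_sigma (m : Fin 6) :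
    (triEmbed (triDir m) * conj (innerNormal (![0, 3, 5, 1, 2, 4] m))).re = 0 := by
  fin_cases m <;> simp [-Complex.mul_re, level_triEmbed_triDir]

/-- The reversed direction lies on the same line: `Re(triDir m · conj n_{σ (m+3)}) = 0`. [folklore] -/
theorem level_triDir_sigma_add_three (m : Fin 6) :
    (triEmbed (triDir m) * conj (innerNormal (![0, 3, 5, 1, 2, 4] (m + 3)))).re = 0 := by
  fin_cases m <;> simp [-Complex.mul_re, level_triEmbed_triDir]

/-- **The signs at the five corner types.** With out-direction `j` at a boundary vertex: at a `60°`
corner (other side `σ (j+4)`, in-ray `j+1`) and a `120°` corner (`σ (j+5)`, in-ray `j+2`) the out-ray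
is at level `+√3/2` of the other side and the in-ray at level `+√3/2` of the out side; at the reflex
`240°` (`σ (j+1)`, in-ray `j+4`) and `300°` (`σ (j+2)`, in-ray `j+5`) corners both levels are `-√3/2`.
[folklore] -/
theorem level_triDir_fan (j : Fin 6) :
    (triEmbed (triDir j) * conj (innerNormal (![0, 3, 5, 1, 2, 4] (j + 4)))).re = Real.sqrt 3 / 2 ∧
    (triEmbed (triDir (j + 1)) * conj (innerNormal (![0, 3, 5, 1, 2, 4] j))).re = Real.sqrt 3 / 2 ∧
    (triEmbed (triDir j) * conj (innerNormal (![0, 3, 5, 1, 2, 4] (j + 5)))).re = Real.sqrt 3 / 2 ∧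
    (triEmbed (triDir (j + 2)) * conj (innerNormal (![0, 3, 5, 1, 2, 4] j))).re = Real.sqrt 3 / 2 ∧
    (triEmbed (triDir j) * conj (innerNormal (![0, 3, 5, 1, 2, 4] (j + 1)))).re = -(Real.sqrt 3 / 2) ∧
    (triEmbed (triDir (j + 4)) * conj (innerNormal (![0, 3, 5, 1, 2, 4] j))).re = -(Real.sqrt 3 / 2) ∧
    (triEmbed (triDir j) * conj (innerNormal (![0, 3, 5, 1, 2, 4] (j + 2)))).re = -(Real.sqrt 3 / 2) ∧
    (triEmbed (triDir (j + 5)) * conj (innerNormal (![0, 3, 5, 1, 2, 4] j))).re = -(Real.sqrt 3 / 2) := by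
  fin_cases j <;> simp [-Complex.mul_re, level_triEmbed_triDir]

/-! ### 2. Small balls on a side near a corner -/

/-- Splitting a level at an intermediate point. [folklore] -/
theorem level_split (n w y z : ℂ) :
    ((w - y) * conj n).re = ((w - z) * conj n).re + ((z - y) * conj n).re := by
  rw [← Complex.add_re, ← add_mul, sub_add_sub_cancel]

/-- The level of `y + d·u` relative to `y` is `d` times the level of `u`. [folklore] -/
theorem level_add_smul (n y u : ℂ) (d : ℝ) : ((y + (d : ℂ) * u - y) * conj n).re = d * (u * conj n).re := by
  rw [add_sub_cancel_left, mul_assoc, Complex.re_ofReal_mul]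

/-- **A point on the side line defines the same half-plane.** [folklore] -/
theorem halfPlane_eq_of_level_eq_zero (κ : Fin 6) {y z : ℂ} (h : ((z - y) * conj (innerNormal κ)).re = 0) :
    halfPlane κ y = halfPlane κ z := by
  ext w
  rw [mem_halfPlane_iff_level, mem_halfPlane_iff_level, level_split (innerNormal κ) w y z, h, add_zero]

/-- `1/2 < √3/2`. [folklore] -/
theorem half_lt_sqrt_three_div_two : (1 : ℝ) / 2 < Real.sqrt 3 / 2 := by
  have : (1 : ℝ) < Real.sqrt 3 := by
    rw [show (1 : ℝ) = Real.sqrt 1 from Real.sqrt_one.symm]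
    exact Real.sqrt_lt_sqrt (by norm_num) (by norm_num)
  linarith

/-- **Convex corner: a ball of radius `r/2` about a point of one side at distance `d ≥ r` from the
corner, on the positive side of the other, sees only the first side.** [folklore] -/
theorem inter_halfPlane_inter_ball_eq (κ κ' : Fin 6) {y z u : ℂ} {d r : ℝ} (hz : z = y + (d : ℂ) * u)
    (h0 : (u * conj (innerNormal κ)).re = 0) (h1 : (u * conj (innerNormal κ')).re = Real.sqrt 3 / 2)
    (hr : 0 < r) (hd : r ≤ d) :
    halfPlane κ y ∩ halfPlane κ' y ∩ ball z (r / 2) = halfPlane κ z ∩ ball z (r / 2) := by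
  have hzy : ((z - y) * conj (innerNormal κ)).re = 0 := by rw [hz, level_add_smul, h0, mul_zero]
  have hzy' : ((z - y) * conj (innerNormal κ')).re = d * (Real.sqrt 3 / 2) := by rw [hz, level_add_smul, h1]
  rw [← halfPlane_eq_of_level_eq_zero κ hzy]
  ext w
  simp only [mem_inter_iff]
  constructor
  · rintro ⟨⟨hw, -⟩, hb⟩; exact ⟨hw, hb⟩
  · rintro ⟨hw, hb⟩
    refine ⟨⟨hw, ?_⟩, hb⟩
    rw [mem_halfPlane_iff_level, level_split (innerNormal κ') w y z, hzy']
    have h2 := abs_level_le_dist κ' z w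
    have h3 : dist w z < r / 2 := hb
    have h4 := neg_abs_le ((w - z) * conj (innerNormal κ')).re
    have h5 := half_lt_sqrt_three_div_two
    nlinarith

/-- **Reflex corner: a ball of radius `r/2` about a point of one side at distance `d ≥ r` from the
corner, on the negative side of the other, sees only the first side.** [folklore] -/
theorem union_halfPlane_inter_ball_eq (κ κ' : Fin 6) {y z u : ℂ} {d r : ℝ} (hz : z = y + (d : ℂ) * u)
    (h0 : (u * conj (innerNormal κ)).re = 0) (h1 : (u * conj (innerNormal κ')).re = -(Real.sqrt 3 / 2))
    (hr : 0 < r) (hd : r ≤ d) :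
    (halfPlane κ y ∪ halfPlane κ' y) ∩ ball z (r / 2) = halfPlane κ z ∩ ball z (r / 2) := by
  have hzy : ((z - y) * conj (innerNormal κ)).re = 0 := by rw [hz, level_add_smul, h0, mul_zero]
  have hzy' : ((z - y) * conj (innerNormal κ')).re = -(d * (Real.sqrt 3 / 2)) := by
    rw [hz, level_add_smul, h1, mul_neg]
  rw [← halfPlane_eq_of_level_eq_zero κ hzy]
  ext w
  simp only [mem_inter_iff, mem_union]
  constructor
  · rintro ⟨hw | hw, hb⟩
    · exact ⟨hw, hb⟩
    · exfalso
      rw [mem_halfPlane_iff_level, level_split (innerNormal κ') w y z, hzy'] at hw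
      have h2 := abs_level_le_dist κ' z w
      have h3 : dist w z < r / 2 := hb
      have h4 := le_abs_self ((w - z) * conj (innerNormal κ')).re
      have h5 := half_lt_sqrt_three_div_two
      nlinarith
  · rintro ⟨hw, hb⟩; exact ⟨Or.inl hw, hb⟩

/-- **Small balls on a side near a corner** (registered form, sub-goal of `stub_innerZigzagPolygon`):
a ball of radius `r/2` about a point of a side at distance `d ≥ r` from the corner sees only that
side, at a convex corner (`∩`) as at a reflex one (`∪`). [folklore] -/
theorem side_ball_geometry : ∀ (κ κ' : Fin 6) (y z u : ℂ) (d r : ℝ), z = y + (d : ℂ) * u → (u * (starRingEnd ℂ) (innerNormal κ)).re = 0 → 0 < r → r ≤ d → ((u * (starRingEnd ℂ) (innerNormal κ')).re = Real.sqrt 3 / 2 → halfPlane κ y ∩ halfPlane κ' y ∩ Metric.ball z (r / 2) = halfPlane κ z ∩ Metric.ball z (r / 2)) ∧ ((u * (starRingEnd ℂ) (innerNormal κ')).re = -(Real.sqrt 3 / 2) → (halfPlane κ y ∪ halfPlane κ' y) ∩ Metric.ball z (r / 2) = halfPlane κ z ∩ Metric.ball z (r / 2)) :=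
  fun κ κ' _ _ _ _ _ hz h0 hr hd =>
    ⟨fun h1 => inter_halfPlane_inter_ball_eq κ κ' hz h0 h1 hr hd,
      fun h1 => union_halfPlane_inter_ball_eq κ κ' hz h0 h1 hr hd⟩

end Summit.CriticalPhenomena.SAWScalingLimit.Theorems.PolygonParitySqueeze.InnerZigzag

end
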